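import Mathlib
import Literature.NumberTheory.EllipticCurves.ModularLinkConjugacy

/-!
# Route `Langlands/SqrtFiveQuarticCovers` — reduction lemma (I₀), absolute form: an integer
# polynomial whose reduction mod `ℓ` has no irreducible factor of degree `≤ [K:ℚ]` has no root in
# the number field `K` (cell `pub/lg-quartmod`, F-L1, sheet 4.5; reusable, closes nothing by itself)

The by-name closure of the σ-free census stubs `CensusMM` / `CensusMI` of `CertB3E7`
(stmt-Langlands-23416; eliminants `SqrtFiveQuarticCoversCertB3E7ZDSEliminant`, p674182) must show
that certain integer polynomials (`F₁₆`, `S₁₆`, `Q₄′`, … of ref-2's ELIMINANTS-E10ZDS.md) have no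
root in any quartic number field `K ∋ √5`.  Mathlib cannot certify irreducibility over `ℚ`, but it
checks finite-field facts by `decide`; this file and its sequel `SqrtFiveQuarticCoversRelReduction`
turn an `𝔽_ℓ[X]`-certificate into «no root in `K`».

* `exists_irreducible_dvd_map_of_root` — the ENGINE: `K` a number field, `ℓ` prime, `𝔓 ∋ ℓ` a
  maximal ideal of `𝓞 K`, `P ∈ ℤ[X]` with `ℓ ∤ lc(P)` and a root `x ∈ K`, `y = lc(P)·x ∈ 𝓞 K`,
  `H ∈ ℤ[X]` with `H(y) ∈ 𝔓` and `H mod ℓ ≠ 0` ⇒ `P mod ℓ` has an irreducible factor of degree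
  `≤ deg (H mod ℓ)` (the minimal polynomial of `ȳ/lc(P) ∈ 𝓞 K ⧸ 𝔓` over `𝔽_ℓ = ZMod ℓ`);
* `aeval_ne_zero_of_irreducible_factors_natDegree_gt_finrank` — **(I₀)**: `ℓ ∤ lc(P)` and every
  irreducible factor of `P mod ℓ` has degree `> [K:ℚ]` ⇒ `∀ x : K, P(x) ≠ 0` (`H = minpoly_ℤ y`,
  of degree `≤ [K:ℚ]`); e.g. `S₁₆ mod 41` irreducible of degree `16 > 4` (ref-2 addendum; ref-1 g2
  DDF pre-replay STATUS 22:40:40Z);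
* `forall_natDegree_gt_of_forall_not_dvd` — adapter from the certificate form
  «`∀ g, 1 ≤ deg g → deg g ≤ d → ¬ g ∣ P̄`» (cell seat in-zanch, form (F)) to the hypothesis form here.

Method: `y = lc(P)·x` is an algebraic integer (`isIntegral_leadingCoeff_smul`, `Polynomial.scaleRoots`
— no «`x` or `x⁻¹` integral» dichotomy); a maximal `𝔓 ∋ ℓ` exists
(`Literature.NumberTheory.EllipticCurves.exists_isMaximal_natCast_mem`, reused); in `𝓞 K ⧸ 𝔓`
(a `ZMod ℓ`-algebra of characteristic `ℓ`; `lc(P)` is a unit there) `x̄ = ȳ/lc(P)` is a root of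
`P mod ℓ` (`scaleRoots_eval₂_mul`), and `minpoly_{𝔽_ℓ} x̄` divides both `P mod ℓ` and
`(H mod ℓ).scaleRoots (lc P)⁻¹`.  No inertia degrees, no valuations.

HONEST STATUS: elementary algebraic number theory about roots of integer polynomials; it serves
certificates about ONE explicit 0-dimensional scheme of the route and proves nothing about
modularity.  Cell record: lead g2 STATUS 2026-08-28T22:29:37Z (ROSTER seat 1b), 22:31:14Z (2),
22:39:53Z (a); ref-2 ELIMINANTS-E10ZDS.md §(I) + addendum.  [folklore; cf. Marcus, *Number Fields*, Ch. 3]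
-/

set_option linter.dupNamespace false -- project-wide option (lakefile weak.linter.dupNamespace); `Summit.Langlands.Langlands` is the mandated namespace

namespace Summit.Langlands.Langlands.Theorems.SqrtFiveQuarticCovers

open Polynomial NumberField Literature.NumberTheory.EllipticCurves

/-! ## 1. The reduction engine: a root of `P` in `K`, scaled by `lc P`, reduced modulo a prime over `ℓ` -/

/-- For `y : 𝓞 K`, evaluation of an integer polynomial commutes with the coercion `𝓞 K → K`. [folklore] -/
theorem coe_aeval_ringOfIntegers {K : Type*} [Field K] [NumberField K] (y : 𝓞 K) (Q : ℤ[X]) :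
    ((aeval y Q : 𝓞 K) : K) = aeval (y : K) Q := by
  rw [RingOfIntegers.coe_eq_algebraMap, ← Polynomial.aeval_algebraMap_apply]

/-- **The engine.**  `K` a number field, `ℓ` a prime, `𝔓` a maximal ideal of `𝓞 K` containing `ℓ`;
`P ∈ ℤ[X]` with `ℓ ∤ lc P` and a root `x ∈ K`; `y ∈ 𝓞 K` with `y = lc(P)·x`; `H ∈ ℤ[X]` with `H(y) ∈ 𝔓`
and `H mod ℓ ≠ 0`.  Then `P mod ℓ` has an irreducible factor of degree `≤ deg (H mod ℓ)` over `𝔽_ℓ`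
(namely the minimal polynomial of `ȳ / lc(P)` in the residue field `𝓞 K ⧸ 𝔓`). [folklore] -/
theorem exists_irreducible_dvd_map_of_root {K : Type*} [Field K] [NumberField K] {ℓ : ℕ}
    [hℓ : Fact ℓ.Prime] {𝔓 : Ideal (𝓞 K)} [𝔓.IsMaximal] (hℓ𝔓 : (ℓ : 𝓞 K) ∈ 𝔓)
    {P : ℤ[X]} (hc : ((P.leadingCoeff : ℤ) : ZMod ℓ) ≠ 0) {x : K} (hx : aeval x P = 0)
    {y : 𝓞 K} (hy : (y : K) = (P.leadingCoeff : K) * x)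
    {H : ℤ[X]} (hH : H.map (Int.castRingHom (ZMod ℓ)) ≠ 0)
    (hHy : aeval y H ∈ 𝔓) :
    ∃ g : (ZMod ℓ)[X], Irreducible g ∧ g ∣ P.map (Int.castRingHom (ZMod ℓ)) ∧
      g.natDegree ≤ (H.map (Int.castRingHom (ZMod ℓ))).natDegree := by
  classical
  haveI : CharP (𝓞 K ⧸ 𝔓) ℓ := charP_quotient_of_natCast_mem hℓ.out hℓ𝔓 (Ideal.IsMaximal.ne_top inferInstance)
  letI : Algebra (ZMod ℓ) (𝓞 K ⧸ 𝔓) := ZMod.algebra _ ℓ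
  set F := 𝓞 K ⧸ 𝔓 with hFdef
  set π : 𝓞 K →+* F := Ideal.Quotient.mk 𝔓 with hπ
  set c : ℤ := P.leadingCoeff with hcdef
  -- ring homs out of `ℤ` agree
  have hcompF : (algebraMap (ZMod ℓ) F).comp (Int.castRingHom (ZMod ℓ)) = Int.castRingHom F :=
    RingHom.ext_int _ _
  have hπcomp : π.comp (algebraMap ℤ (𝓞 K)) = Int.castRingHom F := RingHom.ext_int _ _
  -- `lc P` is a unit in the residue ring
  have hac : (algebraMap (ZMod ℓ) F) (c : ZMod ℓ) = (c : F) := map_intCast _ c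
  have hcu : IsUnit (c : F) := by
    rw [← hac]
    exact (isUnit_iff_ne_zero.2 hc).map _
  obtain ⟨u, hu⟩ : ∃ u : F, (c : F) * u = 1 := hcu.exists_right_inv
  have hau : (algebraMap (ZMod ℓ) F) ((c : ZMod ℓ)⁻¹) = u := by
    have h0 : (algebraMap (ZMod ℓ) F) ((c : ZMod ℓ)⁻¹) * (c : F) = 1 := by
      rw [← hac, ← map_mul, inv_mul_cancel₀ hc, map_one]
    rw [← mul_one ((algebraMap (ZMod ℓ) F) _), ← hu, ← mul_assoc, h0, one_mul]
  -- `ȳ` is a root of `P.scaleRoots c`; `x̄ := u · ȳ` (`u = c̄⁻¹`) is a root of `P`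
  have hPy : aeval y (P.scaleRoots c) = 0 := by
    have h1 : aeval (y : K) (P.scaleRoots c) = 0 := by
      rw [hy]
      have h2 := scaleRoots_aeval_eq_zero (r := c) hx
      rwa [algebraMap_int_eq, Int.coe_castRingHom] at h2
    have h3 : ((aeval y (P.scaleRoots c) : 𝓞 K) : K) = 0 := by
      rw [coe_aeval_ringOfIntegers, h1]
    exact_mod_cast h3
  have hPyF : (P.scaleRoots c).eval₂ (Int.castRingHom F) (π y) = 0 := by
    have h1 := congrArg π hPy
    rw [map_zero, aeval_def, hom_eval₂, hπcomp] at h1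
    exact h1
  set xb : F := u * π y with hxb
  have hcxb : (c : F) * xb = π y := by rw [hxb, ← mul_assoc, hu, one_mul]
  have hPxb : P.eval₂ (Int.castRingHom F) xb = 0 := by
    have h := scaleRoots_eval₂_mul (Int.castRingHom F) xb c (p := P)
    rw [eq_intCast, hcxb, hPyF] at h
    exact ((hcu.pow P.natDegree).mul_right_eq_zero).1 h.symm
  have hPbar : aeval xb (P.map (Int.castRingHom (ZMod ℓ))) = 0 := by
    rw [aeval_def, eval₂_map, hcompF]
    exact hPxb
  -- `x̄` is a root of `(H mod ℓ).scaleRoots c̄⁻¹`, a nonzero polynomial of the same degree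
  have hHyF : H.eval₂ (Int.castRingHom F) (π y) = 0 := by
    have h1 : π (aeval y H) = 0 := (Ideal.Quotient.eq_zero_iff_mem).2 hHy
    rw [aeval_def, hom_eval₂, hπcomp] at h1
    exact h1
  have hHbar : (H.map (Int.castRingHom (ZMod ℓ))).eval₂ (algebraMap (ZMod ℓ) F) (π y) = 0 := by
    rw [eval₂_map, hcompF]
    exact hHyF
  set H' : (ZMod ℓ)[X] := (H.map (Int.castRingHom (ZMod ℓ))).scaleRoots ((c : ZMod ℓ)⁻¹) with hH'
  have hH'0 : H' ≠ 0 := scaleRoots_ne_zero hH _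
  have hH'xb : aeval xb H' = 0 := by
    have h := scaleRoots_eval₂_mul (algebraMap (ZMod ℓ) F) (π y) ((c : ZMod ℓ)⁻¹)
      (p := H.map (Int.castRingHom (ZMod ℓ)))
    rw [hau, ← hxb, hHbar, mul_zero] at h
    rw [aeval_def]
    exact h
  -- the minimal polynomial of `x̄` over `𝔽_ℓ`
  have halg : IsAlgebraic (ZMod ℓ) xb := ⟨H', hH'0, hH'xb⟩
  have hint : IsIntegral (ZMod ℓ) xb := halg.isIntegral
  refine ⟨minpoly (ZMod ℓ) xb, minpoly.irreducible hint, minpoly.dvd (ZMod ℓ) xb hPbar, ?_⟩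
  have hdvd : minpoly (ZMod ℓ) xb ∣ H' := minpoly.dvd (ZMod ℓ) xb hH'xb
  have h := natDegree_le_of_dvd hdvd hH'0
  rwa [hH', natDegree_scaleRoots] at h

/-! ## 2. (I₀) The absolute reduction lemma -/

/-- **(I₀) Absolute reduction lemma.**  Let `K` be a number field, `ℓ` a prime and `P ∈ ℤ[X]` with
`ℓ ∤ lc(P)`.  If every irreducible factor of `P mod ℓ` in `𝔽_ℓ[X]` has degree `> [K:ℚ]`, then `P`
has no root in `K`.  (Proof: `y = lc(P)·x ∈ 𝓞 K`; reduce modulo a prime `𝔓 ∣ ℓ`; the minimal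
polynomial of `ȳ/lc(P)` over `𝔽_ℓ` divides `P mod ℓ` and `minpoly_ℤ(y) mod ℓ`, of degree
`≤ [K:ℚ]`.)  Plug-in form for `𝔽_ℓ[X]`-gcd certificates («`P mod ℓ` has no factor of degree
`≤ [K:ℚ]`»), e.g. `S₁₆ mod 41` irreducible of degree `16 > 4` (cell lg-quartmod, ref-2
ELIMINANTS-E10ZDS.md addendum). [folklore] -/
theorem aeval_ne_zero_of_irreducible_factors_natDegree_gt_finrank {K : Type*} [Field K]
    [NumberField K] {ℓ : ℕ} [Fact ℓ.Prime] {P : ℤ[X]}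
    (hc : ((P.leadingCoeff : ℤ) : ZMod ℓ) ≠ 0)
    (hP : ∀ g : (ZMod ℓ)[X], Irreducible g → g ∣ P.map (Int.castRingHom (ZMod ℓ)) →
      Module.finrank ℚ K < g.natDegree)
    (x : K) : aeval x P ≠ 0 := by
  intro hx
  -- `y = lc(P)·x` is an algebraic integer
  have hyint : IsIntegral ℤ ((P.leadingCoeff : K) * x) := by
    have h := isIntegral_leadingCoeff_smul P x hx
    rwa [Algebra.smul_def, algebraMap_int_eq, Int.coe_castRingHom] at h
  set y : 𝓞 K := ⟨(P.leadingCoeff : K) * x, hyint⟩ with hydef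
  have hy : (y : K) = (P.leadingCoeff : K) * x := rfl
  obtain ⟨𝔓, h𝔓, hℓ𝔓⟩ := exists_isMaximal_natCast_mem (K := K) (Fact.out : ℓ.Prime)
  -- `H := minpoly_ℤ y`, monic of degree `≤ [K:ℚ]`
  set H : ℤ[X] := minpoly ℤ (y : K) with hHdef
  have hHm : H.Monic := minpoly.monic hyint
  have hHy : aeval y H ∈ 𝔓 := by
    have h0 : aeval y H = 0 := by
      have h1 : ((aeval y H : 𝓞 K) : K) = 0 := by rw [coe_aeval_ringOfIntegers, hHdef, minpoly.aeval]
      exact_mod_cast h1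
    rw [h0]
    exact 𝔓.zero_mem
  have hH0 : H.map (Int.castRingHom (ZMod ℓ)) ≠ 0 := (hHm.map _).ne_zero
  have hdeg : (H.map (Int.castRingHom (ZMod ℓ))).natDegree ≤ Module.finrank ℚ K := by
    rw [hHm.natDegree_map]
    have h1 : minpoly ℚ (y : K) = H.map (algebraMap ℤ ℚ) :=
      minpoly.isIntegrallyClosed_eq_field_fractions' ℚ hyint
    have h2 : (minpoly ℚ (y : K)).natDegree = H.natDegree := by rw [h1, hHm.natDegree_map]
    rw [← h2]
    exact minpoly.natDegree_le _
  obtain ⟨g, hgirr, hgdvd, hgdeg⟩ := exists_irreducible_dvd_map_of_root hℓ𝔓 hc hx hy hH0 hHy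
  exact absurd (hP g hgirr hgdvd) (not_lt.2 (hgdeg.trans hdeg))

/-- Adapter from the certificate form «`P̄` has no factor of degree `1 ≤ deg ≤ d`» (any field `F`)
to the hypothesis form of (I₀)/(I) «every irreducible factor of `P̄` has degree `> d`». [folklore] -/
theorem forall_natDegree_gt_of_forall_not_dvd {F : Type*} [Field F] {Q : F[X]} {d : ℕ}
    (h : ∀ g : F[X], 1 ≤ g.natDegree → g.natDegree ≤ d → ¬ g ∣ Q) :
    ∀ g : F[X], Irreducible g → g ∣ Q → d < g.natDegree := fun g hg hgQ =>
  lt_of_not_ge fun hle => h g hg.natDegree_pos hle hgQ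

end Summit.Langlands.Langlands.Theorems.SqrtFiveQuarticCovers
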